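import Mathlib
import HarnessLib
import Literature.MathematicalPhysics.StatisticalMechanics.PolymerProductBound
import Literature.MathematicalPhysics.StatisticalMechanics.PolymerProductDifference

/-!
# Lemma 9.4 of [ABKM19] in LIPSCHITZ form (abstract brick): the map `P₂(F,K)(X) = Σ_{Y ∈ 𝓟_k(X)} F^{X∖Y} K(Y)`
# is Lipschitz in `(F, K)`:
# `|P₂(F,K)(X) − P₂(F',K')(X)|_{T,w} ≤ Σ_{Y ∈ 𝓟_k(X)} [ (∏_{B ∈ 𝓑(X∖Y)}(a_B+δ_B) − ∏_B a_B)·c_Y + (∏_B a_B)·ρ_Y ]`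

[ABKM19] Lemma 9.4 proves that `P₂(I,K) = (I − 1) ∘ K` is smooth with explicit bounds on all
derivatives; the renormalisation-group flow of the crux line `gnv` (crux `HypACumulant` of
`Summits/HubbardSuperconductivity`) needs only the FIRST-ORDER (Lipschitz) statement, in the
derivative-free form "difference of values at two points": with `Z = X ∖ Y`,
`F^Z K(Y) − F'^Z K'(Y) = (F^Z − F'^Z)·K(Y) + F'^Z·(K(Y) − K'(Y))`, the first product is bounded by
`PolymerProductDifference.tayNormLE_bprod_sub_bprod` (`∏(a+δ) − ∏ a`) times `|K(Y)| ≤ c_Y`, the second by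
`PolymerProductBound.tayNormLE_bprod` (`∏ a`) times `|K(Y) − K'(Y)| ≤ ρ_Y`, under the same weight
inequality `(∏_{B ∈ 𝓑(X∖Y)} W^B)·w^Y ≤ w` ((w5)) as the zeroth-order brick
`PolymerProductBound.tayNormLE_sum_bprod_mul`.

* `tayNormLE_bprod_mul_sub` — one term: `|F^Z K − F'^Z K'|_{T,w} ≤ (∏(a+δ) − ∏ a)·c + (∏ a)·ρ`;
* **`tayNormLE_sum_bprod_mul_sub`** — the displayed Lipschitz bound for `P₂`.

Abstract in the gauges `T_B ≤ T`, `T_Y ≤ T`, the block weights `W^B`, polymer weights `w^Y` and the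
target weight `w`; the concrete torus instance (strong weight `W_k^B`, `w_k^Y`, `F = e^{−H} − 1`,
Lemma 9.3 Lipschitz, Lemma 8.3 (i) for `K − K'`) is assembled from this brick exactly as
`PolymerProductABKM.tayNormLE_P2_abkm` is from the zeroth-order one.  Everything is proved; no named fact.

## References
* S. Adams, S. Buchholz, R. Kotecký, S. Müller, *Cauchy–Born rule from microscopic models with
  non-convex potentials*, arXiv:1910.13564, Lemma 9.4 ((9.18)–(9.21)), Lemma 8.3
  [AdamsBuchholzKoteckyMuller2019].
-/

noncomputable section

namespace Literature.MathematicalPhysics.StatisticalMechanics.GradientRG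

open scoped BigOperators Classical
open Finset
open Literature.MathematicalPhysics.StatisticalMechanics.TorusPolymer
  (IsPolymer blocks polys bprod mem_polys)
open Literature.MathematicalPhysics.QuantumFieldTheory

variable {d M : ℕ} [NeZero M]
  {V : Type*} [NormedAddCommGroup V] [NormedSpace ℝ V]
  {Vb : Finset (Fin d → ZMod M) → Type*} [∀ B, NormedAddCommGroup (Vb B)] [∀ B, NormedSpace ℝ (Vb B)]
  {Vp : Finset (Fin d → ZMod M) → Type*} [∀ Y, NormedAddCommGroup (Vp Y)] [∀ Y, NormedSpace ℝ (Vp Y)]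

/-- **One term of the Lipschitz bound for `P₂`**: for an `s`-polymer `Z`, block functionals `F, F'`
with `|F'(B)|_{T_B,W^B} ≤ a_B`, `|F(B) − F'(B)|_{T_B,W^B} ≤ δ_B`, and functionals `K, K'` with
`|K|_{T_Y,w^Y} ≤ c`, `|K − K'|_{T_Y,w^Y} ≤ ρ` (all `C^{r₀}`, local, constants `≥ 0`, gauges `≤ T`), and
the weight inequality `(∏_{B ∈ 𝓑(Z)} W^B)·w^Y ≤ w`:
`|F^Z K − F'^Z K'|_{T,w} ≤ (∏_B (a_B + δ_B) − ∏_B a_B)·c + (∏_B a_B)·ρ`.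
[cite: AdamsBuchholzKoteckyMuller2019, Lemma 9.4 ((9.20)–(9.21), first order)] -/
theorem tayNormLE_bprod_mul_sub (s : ℕ) (T : ((Fin d → ZMod M) → ℝ) →ₗ[ℝ] V)
    (Tb : ∀ B : Finset (Fin d → ZMod M), ((Fin d → ZMod M) → ℝ) →ₗ[ℝ] Vb B)
    {Y : Finset (Fin d → ZMod M)} (TY : ((Fin d → ZMod M) → ℝ) →ₗ[ℝ] Vp Y) {r₀ : ℕ}
    {W : Finset (Fin d → ZMod M) → ((Fin d → ZMod M) → ℝ) → ℝ} {wY w : ((Fin d → ZMod M) → ℝ) → ℝ}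
    {F F' : Finset (Fin d → ZMod M) → ((Fin d → ZMod M) → ℝ) → ℂ}
    {K K' : ((Fin d → ZMod M) → ℝ) → ℂ} {a δ : Finset (Fin d → ZMod M) → ℝ} {c ρ : ℝ}
    {Z : Finset (Fin d → ZMod M)} (hZ : IsPolymer s Z)
    (hF' : ∀ B ∈ blocks s Z, TayNormLE (Tb B) r₀ (W B) (F' B) (a B))
    (hΔF : ∀ B ∈ blocks s Z, TayNormLE (Tb B) r₀ (W B) (fun φ => F B φ - F' B φ) (δ B))
    (hleb : ∀ B ∈ blocks s Z, ∀ ξ, ‖Tb B ξ‖ ≤ ‖T ξ‖)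
    (hFd : ∀ B ∈ blocks s Z, ContDiff ℝ r₀ (F B)) (hF'd : ∀ B ∈ blocks s Z, ContDiff ℝ r₀ (F' B))
    (hFloc : ∀ B ∈ blocks s Z, IsGaugeLocal (Tb B) (F B))
    (hF'loc : ∀ B ∈ blocks s Z, IsGaugeLocal (Tb B) (F' B))
    (ha : ∀ B ∈ blocks s Z, 0 ≤ a B) (hδ : ∀ B ∈ blocks s Z, 0 ≤ δ B)
    (hK : TayNormLE TY r₀ wY K c) (hΔK : TayNormLE TY r₀ wY (fun φ => K φ - K' φ) ρ)
    (hlep : ∀ ξ, ‖TY ξ‖ ≤ ‖T ξ‖) (hKd : ContDiff ℝ r₀ K) (hK'd : ContDiff ℝ r₀ K')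
    (hKloc : IsGaugeLocal TY K) (hK'loc : IsGaugeLocal TY K') (hc : 0 ≤ c) (hρ : 0 ≤ ρ)
    (hw : ∀ φ, (∏ B ∈ blocks s Z, W B φ) * wY φ ≤ w φ) :
    TayNormLE T r₀ w
      (fun φ => bprod s (fun B => F B φ) Z * K φ - bprod s (fun B => F' B φ) Z * K' φ)
      (((∏ B ∈ blocks s Z, (a B + δ B)) - ∏ B ∈ blocks s Z, a B) * c + (∏ B ∈ blocks s Z, a B) * ρ) := by
  -- smoothness and locality of the block products
  have hcd : ∀ {G : Finset (Fin d → ZMod M) → ((Fin d → ZMod M) → ℝ) → ℂ},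
      (∀ B ∈ blocks s Z, ContDiff ℝ r₀ (G B)) → ContDiff ℝ r₀ (fun φ => bprod s (fun B => G B φ) Z) := by
    intro G hG
    unfold TorusPolymer.bprod
    exact contDiff_prod fun B hB => hG B hB
  have hlc : ∀ {G : Finset (Fin d → ZMod M) → ((Fin d → ZMod M) → ℝ) → ℂ},
      (∀ B ∈ blocks s Z, IsGaugeLocal (Tb B) (G B)) → IsGaugeLocal T (fun φ => bprod s (fun B => G B φ) Z) := by
    intro G hG
    unfold TorusPolymer.bprod
    exact IsGaugeLocal.prod _ fun B hB => (hG B hB).of_norm_le (hleb B hB)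
  have hPd : ContDiff ℝ r₀ (fun φ => bprod s (fun B => F B φ) Z) := hcd hFd
  have hP'd : ContDiff ℝ r₀ (fun φ => bprod s (fun B => F' B φ) Z) := hcd hF'd
  have hPloc : IsGaugeLocal T (fun φ => bprod s (fun B => F B φ) Z) := hlc hFloc
  have hP'loc : IsGaugeLocal T (fun φ => bprod s (fun B => F' B φ) Z) := hlc hF'loc
  have hΔKd : ContDiff ℝ r₀ (fun φ => K φ - K' φ) := hKd.sub hK'd
  have hΔKloc : IsGaugeLocal TY (fun φ => K φ - K' φ) := fun φ ψ h => by
    show K φ - K' φ = K ψ - K' ψ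
    rw [hKloc φ ψ h, hK'loc φ ψ h]
  have hprod_le : ∏ B ∈ blocks s Z, a B ≤ ∏ B ∈ blocks s Z, (a B + δ B) :=
    prod_le_prod (fun B hB => ha B hB) fun B hB => le_add_of_nonneg_right (hδ B hB)
  have ha0 : 0 ≤ ∏ B ∈ blocks s Z, a B := prod_nonneg fun B hB => ha B hB
  -- first product: `(F^Z − F'^Z)·K`
  have h1 : TayNormLE T r₀ w
      (fun φ => (bprod s (fun B => F B φ) Z - bprod s (fun B => F' B φ) Z) * K φ)
      (((∏ B ∈ blocks s Z, (a B + δ B)) - ∏ B ∈ blocks s Z, a B) * c) := by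
    have hD := tayNormLE_bprod_sub_bprod s T Tb hZ hF' hΔF hleb hFd hF'd hFloc hF'loc ha hδ
    exact TayNormLE.mul (T := T) (w := w)
      (K₁ := fun φ => bprod s (fun B => F B φ) Z - bprod s (fun B => F' B φ) Z) (K₂ := K)
      hD hK (fun ξ => le_rfl) hlep (hPd.sub hP'd) hKd
      (fun φ ψ h => by
        have e1 := hPloc φ ψ h
        have e2 := hP'loc φ ψ h
        simp only at e1 e2
        show bprod s (fun B => F B φ) Z - bprod s (fun B => F' B φ) Z =
          bprod s (fun B => F B ψ) Z - bprod s (fun B => F' B ψ) Z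
        rw [e1, e2])
      hKloc (sub_nonneg.2 hprod_le) hc hw
  -- second product: `F'^Z·(K − K')`
  have h2 : TayNormLE T r₀ w
      (fun φ => bprod s (fun B => F' B φ) Z * (K φ - K' φ)) ((∏ B ∈ blocks s Z, a B) * ρ) := by
    have hP := tayNormLE_bprod s T Tb Z hF' hleb hF'd hF'loc ha
    exact TayNormLE.mul (T := T) (w := w)
      (K₁ := fun φ => bprod s (fun B => F' B φ) Z) (K₂ := fun φ => K φ - K' φ)
      hP hΔK (fun ξ => le_rfl) hlep hP'd hΔKd hP'loc hΔKloc ha0 hρ hw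
  -- add
  have hsum := TayNormLE.add (T := T) (w := w) h1 h2 ((hPd.sub hP'd).mul hKd) (hP'd.mul hΔKd)
  have hfun : (fun φ => bprod s (fun B => F B φ) Z * K φ - bprod s (fun B => F' B φ) Z * K' φ) =
      ((fun φ => (bprod s (fun B => F B φ) Z - bprod s (fun B => F' B φ) Z) * K φ) +
        fun φ => bprod s (fun B => F' B φ) Z * (K φ - K' φ)) := by
    funext φ
    simp only [Pi.add_apply]
    ring
  rw [hfun]
  exact hsum

/-- **Lemma 9.4 of [ABKM19], Lipschitz form: `P₂(F,K)(X) = Σ_{Y ∈ 𝓟_k(X)} F^{X∖Y} K(Y)` is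
Lipschitz in `(F,K)`.**  For an `s`-polymer `X`, block functionals with `|F'(B)|_{T_B,W^B} ≤ a_B`,
`|F(B) − F'(B)|_{T_B,W^B} ≤ δ_B`, polymer functionals with `|K(Y)|_{T_Y,w^Y} ≤ c_Y`,
`|K(Y) − K'(Y)|_{T_Y,w^Y} ≤ ρ_Y` for `Y ∈ 𝓟_k(X)` (all `C^{r₀}`, local, constants `≥ 0`, gauges
dominated by `T`), and the weight inequality `(∏_{B ∈ 𝓑(X∖Y)} W^B)·w^Y ≤ w` ((w5)):
`|Σ_Y F^{X∖Y} K(Y) − Σ_Y F'^{X∖Y} K'(Y)|_{T,w}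
  ≤ Σ_{Y ∈ 𝓟_k(X)} [ (∏_{B ∈ 𝓑(X∖Y)}(a_B + δ_B) − ∏_B a_B)·c_Y + (∏_{B ∈ 𝓑(X∖Y)} a_B)·ρ_Y ]`.
[cite: AdamsBuchholzKoteckyMuller2019, Lemma 9.4 ((9.18)–(9.21), first order)] -/
theorem tayNormLE_sum_bprod_mul_sub (s : ℕ) (T : ((Fin d → ZMod M) → ℝ) →ₗ[ℝ] V)
    (Tb : ∀ B : Finset (Fin d → ZMod M), ((Fin d → ZMod M) → ℝ) →ₗ[ℝ] Vb B)
    (Tp : ∀ Y : Finset (Fin d → ZMod M), ((Fin d → ZMod M) → ℝ) →ₗ[ℝ] Vp Y) {r₀ : ℕ}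
    {W wp : Finset (Fin d → ZMod M) → ((Fin d → ZMod M) → ℝ) → ℝ} {w : ((Fin d → ZMod M) → ℝ) → ℝ}
    {F F' K K' : Finset (Fin d → ZMod M) → ((Fin d → ZMod M) → ℝ) → ℂ}
    {a δ c ρ : Finset (Fin d → ZMod M) → ℝ} {X : Finset (Fin d → ZMod M)} (hX : IsPolymer s X)
    (hF' : ∀ B ∈ blocks s X, TayNormLE (Tb B) r₀ (W B) (F' B) (a B))
    (hΔF : ∀ B ∈ blocks s X, TayNormLE (Tb B) r₀ (W B) (fun φ => F B φ - F' B φ) (δ B))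
    (hleb : ∀ B ∈ blocks s X, ∀ ξ, ‖Tb B ξ‖ ≤ ‖T ξ‖)
    (hFd : ∀ B ∈ blocks s X, ContDiff ℝ r₀ (F B)) (hF'd : ∀ B ∈ blocks s X, ContDiff ℝ r₀ (F' B))
    (hFloc : ∀ B ∈ blocks s X, IsGaugeLocal (Tb B) (F B))
    (hF'loc : ∀ B ∈ blocks s X, IsGaugeLocal (Tb B) (F' B))
    (ha : ∀ B ∈ blocks s X, 0 ≤ a B) (hδ : ∀ B ∈ blocks s X, 0 ≤ δ B)
    (hK : ∀ Y ∈ polys s X, TayNormLE (Tp Y) r₀ (wp Y) (K Y) (c Y))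
    (hΔK : ∀ Y ∈ polys s X, TayNormLE (Tp Y) r₀ (wp Y) (fun φ => K Y φ - K' Y φ) (ρ Y))
    (hlep : ∀ Y ∈ polys s X, ∀ ξ, ‖Tp Y ξ‖ ≤ ‖T ξ‖)
    (hKd : ∀ Y ∈ polys s X, ContDiff ℝ r₀ (K Y)) (hK'd : ∀ Y ∈ polys s X, ContDiff ℝ r₀ (K' Y))
    (hKloc : ∀ Y ∈ polys s X, IsGaugeLocal (Tp Y) (K Y))
    (hK'loc : ∀ Y ∈ polys s X, IsGaugeLocal (Tp Y) (K' Y))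
    (hc : ∀ Y ∈ polys s X, 0 ≤ c Y) (hρ : ∀ Y ∈ polys s X, 0 ≤ ρ Y)
    (hw : ∀ Y ∈ polys s X, ∀ φ, (∏ B ∈ blocks s (X \ Y), W B φ) * wp Y φ ≤ w φ) :
    TayNormLE T r₀ w
      (fun φ => ∑ Y ∈ polys s X, bprod s (fun B => F B φ) (X \ Y) * K Y φ -
        ∑ Y ∈ polys s X, bprod s (fun B => F' B φ) (X \ Y) * K' Y φ)
      (∑ Y ∈ polys s X, (((∏ B ∈ blocks s (X \ Y), (a B + δ B)) - ∏ B ∈ blocks s (X \ Y), a B) * c Y +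
        (∏ B ∈ blocks s (X \ Y), a B) * ρ Y)) := by
  have hfun : (fun φ => ∑ Y ∈ polys s X, bprod s (fun B => F B φ) (X \ Y) * K Y φ -
        ∑ Y ∈ polys s X, bprod s (fun B => F' B φ) (X \ Y) * K' Y φ) =
      fun φ => ∑ Y ∈ polys s X,
        (bprod s (fun B => F B φ) (X \ Y) * K Y φ - bprod s (fun B => F' B φ) (X \ Y) * K' Y φ) := by
    funext φ; rw [sum_sub_distrib]
  rw [hfun]
  have hterm : ∀ Y ∈ polys s X, TayNormLE T r₀ w
      (fun φ => bprod s (fun B => F B φ) (X \ Y) * K Y φ - bprod s (fun B => F' B φ) (X \ Y) * K' Y φ)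
      (((∏ B ∈ blocks s (X \ Y), (a B + δ B)) - ∏ B ∈ blocks s (X \ Y), a B) * c Y +
        (∏ B ∈ blocks s (X \ Y), a B) * ρ Y) := by
    intro Y hY
    have hsub : blocks s (X \ Y) ⊆ blocks s X := TorusPolymer.blocks_mono s sdiff_subset
    have hZ : IsPolymer s (X \ Y) := hX.sdiff (mem_polys.1 hY).2
    exact tayNormLE_bprod_mul_sub s T Tb (Tp Y) hZ (fun B hB => hF' B (hsub hB))
      (fun B hB => hΔF B (hsub hB)) (fun B hB => hleb B (hsub hB)) (fun B hB => hFd B (hsub hB))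
      (fun B hB => hF'd B (hsub hB)) (fun B hB => hFloc B (hsub hB)) (fun B hB => hF'loc B (hsub hB))
      (fun B hB => ha B (hsub hB)) (fun B hB => hδ B (hsub hB)) (hK Y hY) (hΔK Y hY) (hlep Y hY)
      (hKd Y hY) (hK'd Y hY) (hKloc Y hY) (hK'loc Y hY) (hc Y hY) (hρ Y hY) (hw Y hY)
  refine TayNormLE.sum (T := T) (r₀ := r₀) (w := w) (polys s X) hterm fun Y _ => ?_
  have hsub : blocks s (X \ Y) ⊆ blocks s X := TorusPolymer.blocks_mono s sdiff_subset
  have hcd : ∀ {G : Finset (Fin d → ZMod M) → ((Fin d → ZMod M) → ℝ) → ℂ},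
      (∀ B ∈ blocks s X, ContDiff ℝ r₀ (G B)) →
        ContDiff ℝ r₀ (fun φ => bprod s (fun B => G B φ) (X \ Y)) := by
    intro G hG
    unfold TorusPolymer.bprod
    exact contDiff_prod fun B hB => hG B (hsub hB)
  exact ((hcd hFd).mul (hKd Y ‹_›)).sub ((hcd hF'd).mul (hK'd Y ‹_›))

end Literature.MathematicalPhysics.StatisticalMechanics.GradientRG

end
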